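import Summits.QuantumFields.YangMills.Theorems.BalabanUVNodesN11SpaceTruncationBorelBDefs
import Summits.QuantumFields.YangMills.Theorems.BalabanUVNodesN11SpaceTruncation

/-!
# DAG node N11 — door (d4), the sixth row: FOR A §2 WITNESS WHOSE 𝐁-TERMS ARE BOREL ALONG THE EMBEDDING, THE NO-EXPANSION 𝐓-STEP IS SPECIFIED WITH
# NO ROW ON THE WITNESS AT ALL (witness-first face)

HEADER — WORK-UNIT METADATA.  Cell `pub-ymgap`, YM-PLAN Track A (HUMAN RULING D-0062), seat `pub-ymgap-dag-n11-d` (g11; R134 fan-out seat N11 [B14], strategy s2),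
route `BalabanUVNodes`, item K1⁷ `StabilityBAtRecordR13SepCoPH` = stmt-QuantumFields-20542 (helper, `--kind proof --supports 20542 --as helper`, count-neutral).
[III] = [Balaban1988Convergent], [IV] = [Balaban1989LargeFieldI].  Over this seat's `…N11SpaceTruncationBorelBDefs` (`retractC`, `spaceTruncR`, law transport, rows),
p589738 `…N11SpaceTruncation` (★★★ `exists_local_witness_clause_succ_of_sLaw₁₃CoPH_of_bgRead`), p589098 `…N11TkReadingSupport`, g10's `…N11FluctTruncation(Defs)`,
p583082 ∕ p584440 ∕ p585753 ∕ p580601 (the 𝐓-step chain), def-R's `BgProvisoΛ`, 12a″'s `RegOn`.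

WHY THIS FILE.  p589738 discharged five of p586165's six «term rows»; the sixth — JOINT measurability of the witness's boundary terms `𝐁^{(j)}(X; ι U, ({S_i}, A))`
in `(U, A)` — follows from NO law (LOCATED-B: print p.260 ∕ (2.41) state regularity of `𝐁` in `(𝐔, 𝐉)` only; r11's `analyticB` is per fixed `a`), so it stays a
row ON THE WITNESS in every ∃-keyed face.  The usable face is WITNESS-FIRST: GIVEN a §2 witness `(t₀, E₀)` at index `k` (`HasSect2FormAtZS … t₀ E₀`, e.g. the
future term values OF RECORD) whose `𝐁`-terms are Borel along the record's embedding jointly with the fluctuation datum, the no-expansion 𝐓-step clause holds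
for the witness `spaceTruncR S k ∘ truncTermValues k ∘ t₀` with NO further row on the witness: g10's fluctuation truncation keeps joint Borel-ness
(`measurable_B_truncTermValues_of_borel`), the radial retraction keeps it and bounds `𝐁` (`…BorelBDefs`), the open-locus truncation handles `𝐄 ∕ 𝐑` (p589408), and the
slot is unchanged on the χ-support given def-R's proviso on the reading support (§1–§2, as p589738 with the retracted `𝐁`: below its bound the retraction is
the identity — no analyticity needed there).

WHAT THIS FILE PROVES (0 `sorry`, 0 `def`).
* §1 `action23_spaceTruncR_eq_of_mem` ∕ §2 ★★ `sect2Slot_spaceTruncR_eq`, ★★ `hasSect2FormAtZS_spaceTruncR` — p589738's §1–§2 for `spaceTruncR`.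
* §3 ★★★★ `exists_local_witness_clause_succ_of_hasSect2FormAtZS_of_borelB_of_bgRead` — from a NAMED §2 witness with Borel `𝐁` along the embedding: p586165's
  conclusion with ALL SIX term rows gone; the remaining rows are K0b's residual rows (pins (P)(V), `quad`, measurability, A-fibre domination), 12a″'s `RegOn`,
  def-R's `BgProvisoΛ` over the reading support, the run's window.

HONEST FRAMING.  Helper lane of K1⁷; kernel bookkeeping + elementary analysis; nothing of Bałaban's is asserted; every analytic input is DISPLAYED as a row on a
primitive of record or on the NAMED input witness.  The expansion steps `Ω_{k+1} ≠ ∅` are untouched ([III] §3 ∕ Thm 2).  N11 NOT discharged; K1⁷ NOT closed;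
counts unmoved (typed 28∕28 · discharged 5∕27).  One finite four-torus programme at fixed `ε = L^{−K}` — NOT ℝ⁴, NOT OS, NOT a mass gap, NOT Clay.  No `sorry`,
`axiom`, `def`, `instance`, `notation`.  Sources (SHAPE only): [III] Theorem p.245, (2.7) p.255, (2.10) p.256, (2.17)–(2.18) p.257, (2.20)–(2.28) pp.258–259,
(2.30)–(2.31) p.260, (2.34)–(2.42) p.261, Thm 1 p.262, (3.24)–(3.25) p.270; [IV] (0.2)–(0.3) p.176; the window `0 < g_j ≤ γ` is [Balaban1987RG1] Thm 3 p.264's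
interval condition (ref-K READ #206 NIT-L1: not [III] (2.46)).
-/

noncomputable section

open MeasureTheory
open scoped BigOperators ENNReal NNReal Matrix.Norms.L2Operator

universe u

namespace Summit.QuantumFields.YangMills.Theorems.BalabanUVNodesN11SpaceTruncationBorelB

open Literature.MathematicalPhysics.QuantumFieldTheory.Balaban1983to89 T4Continuum T4NestedCovariance Node00 Node00.Tk DagBinding
open B15DeterminingSets B8Eq17ClassAkV1 Step B14.Eq227LocalizedTerms B14.Eq225Concrete
open BalabanUVNodesN11FluctTruncationDefs (IsFluctLocal truncTermValues isFluctLocal_truncTermValues lawsRT_truncTermValues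
  action23_sect2ActionDataOfRecord_congr_fluct_of_isFluctLocal)
open BalabanUVNodesN11OpenLocusTruncationDefs BalabanUVNodesN11SpaceTruncationDefs BalabanUVNodesN11SpaceTruncationBorelBDefs BalabanUVNodesN11TkReadingSupport
open BalabanUVNodesN11FluctTruncation (hasSect2FormAtZS_truncTermValues)
open BalabanUVNodesN11NoExpansionOldBranchGraph (clause_succ_CoPH_of_Omega_empty_of_pinChi_of_oldBranch_of_clause_of_graph)
open BalabanUVNodesN11OldBranchIntegrableOfDominated (integrable_oldBranch_of_dominated)
open BalabanUVNodesN11OperandRowsOfTermRows (measurable_sect2Operand_of_termRows exists_bound_sect2Operand_of_termBounds)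
open BalabanUVNodesN11BackgroundCoPMeasurable (measurable_UbgOfRecord₁₃CoP)

/-! ## §1  The (2.23) action of the retracted family at a configuration read inside the spaces -/

section Action

variable {P : Params} {𝔸 : Type*} [NormedRing 𝔸] [NormedAlgebra ℂ 𝔸] [CompleteSpace 𝔸] {V : Type u} {M : ℕ} {G : Type*} [GaugeGroup G]

/-- **THE (2.23) ACTION OF THE RETRACTED FAMILY IS THE ACTION** at a background read inside the spaces on print's ranges (as p589738's
`action23_spaceTrunc_eq_of_mem`; the `𝐁`-terms agree because the retraction is the identity below the (2.42) bound). [cite: Balaban1988Convergent, (2.23) p.258, (2.26)–(2.28) p.259, (2.30)–(2.31) p.260, (2.41)–(2.42) p.261] -/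
theorem action23_spaceTruncR_eq_of_mem (S : Sect2.Setting 𝔸 G) (Rz : Sect2.Residual P 𝔸) (ν : Stage7Numerics) (g : ℕ → ℝ) (Ω Λ : ℕ → Set (Site P 0))
    (t : Sect2.TermValues P 𝔸 V M) {n n₀ : ℕ} (hn : n ≤ n₀) (a : SFluct P V) (Ek : ℝ) (U : GaugeField P 0 G)
    (hlaw : Sect2.LawsRT (Sect2.towerOfTerms S Rz M Ω t) S.lf n)
    (hg : ∀ j, 1 ≤ j → j ≤ n → 0 ≤ S.flow.g (j - 1) ∧ S.flow.g (j - 1) ≤ S.lf.γ)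
    (h1 : ∀ j, 1 ≤ j → j ≤ n → ∀ X : (Sect2.domSys P M j).Dom,
      Sect2.ofBackgroundC S.ι (1 : GaugeField P 0 G) ∈ Sect2.spaceI S Rz M j (Sect2.domSites P M j X) (S.lf.alpha0 (S.flow.g j)) (S.lf.alpha1 (S.flow.g j)))
    (hI : ∀ j, 1 ≤ j → j ≤ n → ∀ X : (Sect2.domSys P M j).Dom, Sect2.domSites P M j X ⊆ Λ j →
      Sect2.ofBackgroundC S.ι U ∈ Sect2.spaceI S Rz M j (Sect2.domSites P M j X) (S.lf.alpha0 (S.flow.g j)) (S.lf.alpha1 (S.flow.g j)))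
    (hMS : ∀ j, 1 ≤ j → j ≤ n → ∀ X : (Sect2.domSys P M j).Dom, Sect2.admB P ν M g Ω Λ j (Sect2.domSites P M j X) = true →
      Sect2.ofBackgroundC S.ι U ∈ Sect2.spaceMS S Rz M j (Sect2.domSites P M j X) Ω) :
    (Sect2.actionDataOfTerms S Rz ν M g Ω Λ (spaceTruncR S n₀ t) n a Ek).action23 n U = (Sect2.actionDataOfTerms S Rz ν M g Ω Λ t n a Ek).action23 n U := by
  obtain ⟨hH, hA⟩ := hlaw
  rw [Sect2.action23_actionDataOfTerms, Sect2.action23_actionDataOfTerms]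
  have hE : E225 (Sect2.towerOfTerms S Rz M Ω (spaceTruncR S n₀ t)) (fun j X z => Sect2.admE P ν M g Λ j (Sect2.domSites P M j X) z) Rz.phi n U =
      E225 (Sect2.towerOfTerms S Rz M Ω t) (fun j X z => Sect2.admE P ν M g Λ j (Sect2.domSites P M j X) z) Rz.phi n U := by
    unfold E225 EjSub
    refine Finset.sum_congr rfl fun j hj => ?_
    obtain ⟨h1j, hjn⟩ := Finset.mem_Icc.mp hj
    congr 1
    refine Finset.sum_congr rfl fun X _ => Finset.sum_congr rfl fun z _ => ?_
    by_cases hadm : Sect2.admE P ν M g Λ j (Sect2.domSites P M j X) z = true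
    · have hX : Sect2.domSites P M j X ⊆ Λ j := ((Sect2.admE_eq_true_iff ν M g Λ j _ z).mp hadm).2.2
      show (if Sect2.admE P ν M g Λ j (Sect2.domSites P M j X) z = true then
          ((spaceTrunc S n₀ t).E j X z (S.flow.g (j - 1)) (Sect2.ofBackgroundC S.ι U)).re -
            ((spaceTrunc S n₀ t).E j X z (S.flow.g (j - 1)) (Sect2.ofBackgroundC S.ι 1)).re else 0) =
        (if Sect2.admE P ν M g Λ j (Sect2.domSites P M j X) z = true then
          (t.E j X z (S.flow.g (j - 1)) (Sect2.ofBackgroundC S.ι U)).re - (t.E j X z (S.flow.g (j - 1)) (Sect2.ofBackgroundC S.ι 1)).re else 0)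
      rw [if_pos hadm, if_pos hadm,
        spaceTrunc_E_eq_of_mem S n₀ t ⟨h1j, hjn.trans hn⟩ X z _ (hA.analyticE j h1j hjn X z _ (hg j h1j hjn).1 (hg j h1j hjn).2 _ (hI j h1j hjn X hX))
          (lt_of_le_of_lt (hH.boundE j h1j hjn X z _ _ (hg j h1j hjn).1 (hg j h1j hjn).2 (hI j h1j hjn X hX)) (lt_thr_left _ _ _ _)),
        spaceTrunc_E_eq_of_mem S n₀ t ⟨h1j, hjn.trans hn⟩ X z _ (hA.analyticE j h1j hjn X z _ (hg j h1j hjn).1 (hg j h1j hjn).2 _ (h1 j h1j hjn X))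
          (lt_of_le_of_lt (hH.boundE j h1j hjn X z _ _ (hg j h1j hjn).1 (hg j h1j hjn).2 (h1 j h1j hjn X)) (lt_thr_left _ _ _ _))]
    · show (if Sect2.admE P ν M g Λ j (Sect2.domSites P M j X) z = true then
          ((spaceTrunc S n₀ t).E j X z (S.flow.g (j - 1)) (Sect2.ofBackgroundC S.ι U)).re -
            ((spaceTrunc S n₀ t).E j X z (S.flow.g (j - 1)) (Sect2.ofBackgroundC S.ι 1)).re else 0) =
        (if Sect2.admE P ν M g Λ j (Sect2.domSites P M j X) z = true then
          (t.E j X z (S.flow.g (j - 1)) (Sect2.ofBackgroundC S.ι U)).re - (t.E j X z (S.flow.g (j - 1)) (Sect2.ofBackgroundC S.ι 1)).re else 0)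
      rw [if_neg hadm, if_neg hadm]
  have hR : R230 (Sect2.towerOfTerms S Rz M Ω (spaceTruncR S n₀ t)) (fun j X => Sect2.admR P ν M g Λ j (Sect2.domSites P M j X)) n U =
      R230 (Sect2.towerOfTerms S Rz M Ω t) (fun j X => Sect2.admR P ν M g Λ j (Sect2.domSites P M j X)) n U := by
    unfold R230
    refine Finset.sum_congr rfl fun j hj => Finset.sum_congr rfl fun X _ => ?_
    obtain ⟨h1j, hjn⟩ := Finset.mem_Icc.mp hj
    by_cases hadm : Sect2.admR P ν M g Λ j (Sect2.domSites P M j X) = true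
    · have hX : Sect2.domSites P M j X ⊆ Λ j :=
        ((Sect2.admR_eq_true_iff ν M g Λ j _).mp hadm).trans (Sect2.innerT_subset _ 1 (Λ j))
      show (if Sect2.admR P ν M g Λ j (Sect2.domSites P M j X) = true then
          ((spaceTrunc S n₀ t).R j X (Sect2.ofBackgroundC S.ι U)).re - ((spaceTrunc S n₀ t).R j X (Sect2.ofBackgroundC S.ι 1)).re else 0) =
        (if Sect2.admR P ν M g Λ j (Sect2.domSites P M j X) = true then
          (t.R j X (Sect2.ofBackgroundC S.ι U)).re - (t.R j X (Sect2.ofBackgroundC S.ι 1)).re else 0)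
      rw [if_pos hadm, if_pos hadm,
        spaceTrunc_R_eq_of_mem S n₀ t ⟨h1j, hjn.trans hn⟩ X (hA.analyticR j h1j hjn X _ (hI j h1j hjn X hX))
          (lt_of_le_of_lt (hH.boundR j h1j hjn X _ (hI j h1j hjn X hX)) (lt_thr_left _ _ _ _)),
        spaceTrunc_R_eq_of_mem S n₀ t ⟨h1j, hjn.trans hn⟩ X (hA.analyticR j h1j hjn X _ (h1 j h1j hjn X))
          (lt_of_le_of_lt (hH.boundR j h1j hjn X _ (h1 j h1j hjn X)) (lt_thr_left _ _ _ _))]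
    · show (if Sect2.admR P ν M g Λ j (Sect2.domSites P M j X) = true then
          ((spaceTrunc S n₀ t).R j X (Sect2.ofBackgroundC S.ι U)).re - ((spaceTrunc S n₀ t).R j X (Sect2.ofBackgroundC S.ι 1)).re else 0) =
        (if Sect2.admR P ν M g Λ j (Sect2.domSites P M j X) = true then
          (t.R j X (Sect2.ofBackgroundC S.ι U)).re - (t.R j X (Sect2.ofBackgroundC S.ι 1)).re else 0)
      rw [if_neg hadm, if_neg hadm]
  have hB : B240 (Sect2.towerOfTerms S Rz M Ω (spaceTruncR S n₀ t)) (fun j X => Sect2.admB P ν M g Ω Λ j (Sect2.domSites P M j X)) a n U =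
      B240 (Sect2.towerOfTerms S Rz M Ω t) (fun j X => Sect2.admB P ν M g Ω Λ j (Sect2.domSites P M j X)) a n U := by
    unfold B240
    refine Finset.sum_congr rfl fun j hj => Finset.sum_congr rfl fun X _ => ?_
    obtain ⟨h1j, hjn⟩ := Finset.mem_Icc.mp hj
    by_cases hadm : Sect2.admB P ν M g Ω Λ j (Sect2.domSites P M j X) = true
    · show (if Sect2.admB P ν M g Ω Λ j (Sect2.domSites P M j X) = true then ((spaceTruncR S n₀ t).B j X (Sect2.ofBackgroundC S.ι U) a).re else 0) =
        (if Sect2.admB P ν M g Ω Λ j (Sect2.domSites P M j X) = true then (t.B j X (Sect2.ofBackgroundC S.ι U) a).re else 0)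
      rw [if_pos hadm, if_pos hadm,
        spaceTruncR_B_eq_of_le S n₀ t ⟨h1j, hjn.trans hn⟩ X a ((hH.boundB j h1j hjn X _ a (hMS j h1j hjn X hadm)).trans (lt_thr_left _ _ _ _).le)]
    · show (if Sect2.admB P ν M g Ω Λ j (Sect2.domSites P M j X) = true then ((spaceTruncR S n₀ t).B j X (Sect2.ofBackgroundC S.ι U) a).re else 0) =
        (if Sect2.admB P ν M g Ω Λ j (Sect2.domSites P M j X) = true then (t.B j X (Sect2.ofBackgroundC S.ι U) a).re else 0)
      rw [if_neg hadm, if_neg hadm]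
  rw [hE, hR, hB]

end Action

/-! ## §2  On the χ-support the slot of the retracted family IS the slot; the §2 form predicate transports -/

section Slot


variable {F : T4Family} {N : ℕ} [NeZero N] {V : Type} [NormedAddCommGroup V] [InnerProductSpace ℝ V] [FiniteDimensional ℝ V] [MeasurableSpace V] [BorelSpace V]
variable {𝔸 : Type*} [NormedRing 𝔸] [NormedAlgebra ℂ 𝔸] [CompleteSpace 𝔸]
variable {ν : Stage7Numerics} {M : ℕ} {g : ℕ → ℝ} {K : ℕ}

/-- **★★ THE §2 SLOT OF THE RETRACTED FAMILY IS THE SLOT** at `V_n` (as p589738's `sect2Slot_spaceTrunc_eq`). [cite: Balaban1988Convergent, (2.18) p.257, (2.20)–(2.23) p.258, (2.26)–(2.28) p.259, (2.30)–(2.31) p.260, (2.41)–(2.42) p.261, (2.10) p.256] -/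
theorem sect2Slot_spaceTruncR_eq (Sg : Sect2.Setting 𝔸 (SU N)) (Rz : Sect2.Residual (F.P K) 𝔸) (W : TkWeights F N V K) {n n₀ : ℕ} (hn : n ≤ n₀)
    (s : SeqOfRecord F ν M g K n) (Reg : (j : ℕ) → GaugeField (F.P K) j (SU N) → Prop)
    (hζ : ∀ j, j < n → ∀ ω : MultiCfg (F.P K) (SU N) V, W.ζ j (s.Ω (j + 1))ᶜ ω ≠ 0 → Reg j (ω j).1)
    (t : Sect2.TermValues (F.P K) 𝔸 V M) (Ek : ℝ) (U : BgMap F N K) (Vn : GaugeField (F.P K) n (SU N))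
    (hlaw : Sect2.LawsRT (sect2TowerOfRecord F N V K Sg Rz s t) Sg.lf n)
    (hg : ∀ j, 1 ≤ j → j ≤ n → 0 ≤ Sg.flow.g (j - 1) ∧ Sg.flow.g (j - 1) ≤ Sg.lf.γ)
    (h1 : ∀ j, 1 ≤ j → j ≤ n → ∀ X : (Sect2.domSys (F.P K) M j).Dom,
      Sect2.ofBackgroundC Sg.ι (1 : GaugeField (F.P K) 0 (SU N)) ∈
        Sect2.spaceI Sg Rz M j (Sect2.domSites (F.P K) M j X) (Sg.lf.alpha0 (Sg.flow.g j)) (Sg.lf.alpha1 (Sg.flow.g j)))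
    (hbg : ∀ Wc : MSField (F.P K) (SU N), Wc n = Vn → (∀ j, j < n → Reg j (Wc j)) → ∀ j, 1 ≤ j → j ≤ n → ∀ X : (Sect2.domSys (F.P K) M j).Dom,
      (Sect2.domSites (F.P K) M j X ⊆ s.Λ j →
        Sect2.ofBackgroundC Sg.ι (U Wc) ∈ Sect2.spaceI Sg Rz M j (Sect2.domSites (F.P K) M j X) (Sg.lf.alpha0 (Sg.flow.g j)) (Sg.lf.alpha1 (Sg.flow.g j))) ∧
      (Sect2.admB (F.P K) ν M g s.Ω s.Λ j (Sect2.domSites (F.P K) M j X) = true →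
        Sect2.ofBackgroundC Sg.ι (U Wc) ∈ Sect2.spaceMS Sg Rz M j (Sect2.domSites (F.P K) M j X) s.Ω)) :
    sect2Slot F N V K Sg Rz W s (spaceTruncR Sg n₀ t) Ek U Vn = sect2Slot F N V K Sg Rz W s t Ek U Vn :=
  sect2Slot_congr_on_read ν M g K W Sg Rz s Reg hζ _ _ Ek Ek U U Vn fun a Wc hW hR => by
    show Real.exp ((Sect2.actionDataOfTerms Sg Rz ν M g s.Ω s.Λ (spaceTruncR Sg n₀ t) n a Ek).action23 n (U Wc)) =
      Real.exp ((Sect2.actionDataOfTerms Sg Rz ν M g s.Ω s.Λ t n a Ek).action23 n (U Wc))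
    rw [action23_spaceTruncR_eq_of_mem Sg Rz ν g s.Ω s.Λ t hn a Ek (U Wc) hlaw hg h1 (fun j h1j hjn X hX => (hbg Wc hW hR j h1j hjn X).1 hX)
      (fun j h1j hjn X hadm => (hbg Wc hW hR j h1j hjn X).2 hadm)]

/-- **★★ THE §2 FORM PREDICATE (laws `LawsRT … k`, history-indexed residual ∕ weights ∕ background) TRANSPORTS TO THE TRUNCATED WITNESS FAMILY**: universality of
`𝐄` and the laws transport (`…SpaceTruncationDefs` §2), and the identity clause holds a.e. on the χ-support because the slot is unchanged there (§2 above, with the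
top scale of the reading support IN the χ-support). [cite: Balaban1988Convergent, (2.17)–(2.18) p.257, Thm 1 p.262, (2.28) p.259, (2.10) p.256] -/
theorem hasSect2FormAtZS_spaceTruncR (Sg : Sect2.Setting 𝔸 (SU N)) {k n₀ : ℕ} (hk : k ≤ n₀) (Rz : SeqOfRecord F ν M g K k → Sect2.Residual (F.P K) 𝔸)
    (W : SeqOfRecord F ν M g K k → TkWeights F N V K) (U : SeqOfRecord F ν M g K k → BgMap F N K)
    (slot : SeqOfRecord F ν M g K k → Density (F.P K) k (SU N))
    (Reg : SeqOfRecord F ν M g K k → (j : ℕ) → GaugeField (F.P K) j (SU N) → Prop)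
    (hζ : ∀ s₀ j, j < k → ∀ ω : MultiCfg (F.P K) (SU N) V, (W s₀).ζ j (s₀.Ω (j + 1))ᶜ ω ≠ 0 → Reg s₀ j (ω j).1)
    (hg : ∀ j, 1 ≤ j → j ≤ k → 0 ≤ Sg.flow.g (j - 1) ∧ Sg.flow.g (j - 1) ≤ Sg.lf.γ)
    (h1 : ∀ s₀ j, 1 ≤ j → j ≤ k → ∀ X : (Sect2.domSys (F.P K) M j).Dom,
      Sect2.ofBackgroundC Sg.ι (1 : GaugeField (F.P K) 0 (SU N)) ∈
        Sect2.spaceI Sg (Rz s₀) M j (Sect2.domSites (F.P K) M j X) (Sg.lf.alpha0 (Sg.flow.g j)) (Sg.lf.alpha1 (Sg.flow.g j)))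
    (hbg : ∀ s₀ (Wc : MSField (F.P K) (SU N)), chiSeqOfRecord F N ν M g K k s₀ (Wc k) ≠ 0 → (∀ j, j < k → Reg s₀ j (Wc j)) →
      ∀ j, 1 ≤ j → j ≤ k → ∀ X : (Sect2.domSys (F.P K) M j).Dom,
      (Sect2.domSites (F.P K) M j X ⊆ s₀.Λ j →
        Sect2.ofBackgroundC Sg.ι (U s₀ Wc) ∈ Sect2.spaceI Sg (Rz s₀) M j (Sect2.domSites (F.P K) M j X) (Sg.lf.alpha0 (Sg.flow.g j)) (Sg.lf.alpha1 (Sg.flow.g j))) ∧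
      (Sect2.admB (F.P K) ν M g s₀.Ω s₀.Λ j (Sect2.domSites (F.P K) M j X) = true →
        Sect2.ofBackgroundC Sg.ι (U s₀ Wc) ∈ Sect2.spaceMS Sg (Rz s₀) M j (Sect2.domSites (F.P K) M j X) s₀.Ω))
    {t : SeqOfRecord F ν M g K k → Sect2.TermValues (F.P K) 𝔸 V M} {Ek : SeqOfRecord F ν M g K k → ℝ}
    (h : HasSect2FormAtZS F N V K Sg k Rz W U (fun s₀ t₀ => Sect2.LawsRT (sect2TowerOfRecord F N V K Sg (Rz s₀) s₀ t₀) Sg.lf k) slot t Ek) :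
    HasSect2FormAtZS F N V K Sg k Rz W U (fun s₀ t₀ => Sect2.LawsRT (sect2TowerOfRecord F N V K Sg (Rz s₀) s₀ t₀) Sg.lf k) slot
      (fun s₀ => spaceTruncR Sg n₀ (t s₀)) Ek := by
  refine ⟨universalE_spaceTruncR h.1 Sg n₀, fun s₀ => ⟨lawsRT_spaceTruncR Sg (Rz s₀) s₀.Ω (t s₀) hk (h.2 s₀).1, ?_⟩⟩
  rcases (h.2 s₀).2 with h0 | hae
  · exact Or.inl h0
  · refine Or.inr ?_
    filter_upwards [hae] with Vn hVn hχ
    rw [hVn hχ]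
    exact (sect2Slot_spaceTruncR_eq Sg (Rz s₀) (W s₀) hk s₀ (Reg s₀) (hζ s₀) (t s₀) (Ek s₀) (U s₀) Vn (h.2 s₀).1 hg (h1 s₀)
      (fun Wc hW hR => hbg s₀ Wc (by rw [hW]; exact hχ) hR)).symm

end Slot

/-! ## §3  AT THE RECORD, WITNESS FIRST: a §2 witness with Borel 𝐁-terms along the embedding gives the 𝐓-step clause with no row on the witness -/

section Record

variable {F : T4Family} {N : ℕ} [NeZero N]

variable (θ : Stage13HParams F N) (p : B12.RunParams)

/-- **★★★★ THE NO-EXPANSION 𝐓-STEP AT A GENERIC STAGE-13 PARAMETER FROM A NAMED §2 WITNESS WITH BOREL 𝐁-TERMS — NO ROW ON THE WITNESS.**  Given `(t₀, E₀)`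
witnessing the §2 form of `ρ_k`'s slots of record at index `k` (`HasSect2FormAtZS`, laws `LawsRT … k`) whose boundary terms, read at the embedded background, are
Borel jointly in the background field and the fluctuation datum (`hBt` — true for explicitly constructed term values), and the rows of p589738 on primitives of
record (run window, 12a″'s `RegOn`, def-R's `BgProvisoΛ` over the reading support), the conclusion of p586165 holds with ALL SIX term rows removed, for the witness
`s₀ ↦ spaceTruncR S k (truncTermValues k (t₀ s₀))`. [cite: Balaban1988Convergent, Theorem p.245, Thm 1 p.262, (2.7) p.255, (2.10) p.256, (2.18) p.257, (2.20)–(2.28) pp.258–259, (2.31) p.260, (2.41)–(2.42) p.261, (3.24)–(3.25) p.270; Balaban1989LargeFieldI, (0.2)–(0.3) p.176; Balaban1987RG1, Thm 3 p.264] -/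
theorem exists_local_witness_clause_succ_of_hasSect2FormAtZS_of_borelB_of_bgRead (h : θ.Provisos₁₃CoPH F N) (hU : θ.ZhUnity F N) (hθ : θ.Admissible F N)
    (hpos : θ.s2.Pos) {k : ℕ} (hk : k < p.K) (hM : 1 ≤ θ.τ9.M) (hw : Step.InInterval θ.γ k (gOfRecord₁₃ F N θ.toStage13Params p))
    (cR : ℝ) (Γr : SeqOfRecord F θ.ν θ.τ9.M (gOfRecord₁₃ F N θ.toStage13Params p) p.K k → ℕ → Set (Site (F.P p.K) 0) → Set (Site (F.P p.K) 0))
    (hreg : ∀ s₀, (θ.zhAt p s₀).RegOn F N (FluctV N) θ.ν cR p (gOfRecord₁₃ F N θ.toStage13Params p) (Γr s₀))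
    (hbg : BgProvisoΛ F N p.K (settingOfRecord₁₃ F N θ.toStage13Params p) (θ.Rz p.K) θ.τ9.M k
      (fun s₀ => {Wc | chiSeqOfRecord F N θ.ν θ.τ9.M (gOfRecord₁₃ F N θ.toStage13Params p) p.K k s₀ (Wc k) ≠ 0 ∧
        ∀ j, j < k → PlaqSmallOn (plaqsOf (pts j (Γr s₀ j (s₀.Ω (j + 1))ᶜ))) (cR * epsOfRecord θ.ν (gOfRecord₁₃ F N θ.toStage13Params p) j) (Wc j)})
      (UbgOfRecord₁₃CoP F N θ.toStage13Params p k))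
    (t₀ : SeqOfRecord F θ.ν θ.τ9.M (gOfRecord₁₃ F N θ.toStage13Params p) p.K k → Sect2.TermValues (F.P p.K) (MatA N) (FluctV N) θ.τ9.M)
    (E₀ : SeqOfRecord F θ.ν θ.τ9.M (gOfRecord₁₃ F N θ.toStage13Params p) p.K k → ℝ)
    (hform₀ : HasSect2FormAtZS F N (FluctV N) p.K (settingOfRecord₁₃ F N θ.toStage13Params p) k (θ.rzAt p) (WtOfRecord₁₃H F N θ p)
      (UbgOfRecord₁₃CoP F N θ.toStage13Params p k)
      (fun s₀ t' => Sect2.LawsRT (sect2TowerOfRecord F N (FluctV N) p.K (settingOfRecord₁₃ F N θ.toStage13Params p) (θ.rzAt p s₀) s₀ t')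
        (settingOfRecord₁₃ F N θ.toStage13Params p).lf k)
      (slotsOfRecord F N θ.ν θ.τ9 (EOfRecord₁₃ F N θ.toStage13Params) (wOfRecord₉ F N θ.toStage9Params) θ.ppSel p (gOfRecord₁₃ F N θ.toStage13Params p) k) t₀ E₀)
    (hBt : ∀ s₀ (S' : ℕ → Set (Site (F.P p.K) 0)) (j : ℕ) (X : (Sect2.domSys (F.P p.K) θ.τ9.M j).Dom),
      Measurable (fun q : GaugeField (F.P p.K) 0 (SU N) × MSFluct (F.P p.K) (FluctV N) =>
        (t₀ s₀).B j X (Sect2.ofBackgroundC (settingOfRecord₁₃ F N θ.toStage13Params p).ι q.1) (S', q.2))) :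
    ∃ (t : SeqOfRecord F θ.ν θ.τ9.M (gOfRecord₁₃ F N θ.toStage13Params p) p.K k → Sect2.TermValues (F.P p.K) (MatA N) (FluctV N) θ.τ9.M)
      (Ek : SeqOfRecord F θ.ν θ.τ9.M (gOfRecord₁₃ F N θ.toStage13Params p) p.K k → ℝ),
      HasSect2FormAtZS F N (FluctV N) p.K (settingOfRecord₁₃ F N θ.toStage13Params p) k (θ.rzAt p) (WtOfRecord₁₃H F N θ p)
          (UbgOfRecord₁₃CoP F N θ.toStage13Params p k)
          (fun s₀ t₀ => Sect2.LawsRT (sect2TowerOfRecord F N (FluctV N) p.K (settingOfRecord₁₃ F N θ.toStage13Params p) (θ.rzAt p s₀) s₀ t₀)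
            (settingOfRecord₁₃ F N θ.toStage13Params p).lf k)
          (slotsOfRecord F N θ.ν θ.τ9 (EOfRecord₁₃ F N θ.toStage13Params) (wOfRecord₉ F N θ.toStage9Params) θ.ppSel p
            (gOfRecord₁₃ F N θ.toStage13Params p) k) t Ek ∧
      (∀ s₀, IsFluctLocal k (t s₀)) ∧
      ∀ (s : SeqOfRecord F θ.ν θ.τ9.M (gOfRecord₁₃ F N θ.toStage13Params p) p.K (k + 1)), s.Ω (k + 1) = ∅ →
        -- (P) prefix agreement below `k`
        (∀ j, j < k → (θ.zhAt p s).ζ0 j = (θ.zhAt p s.init).ζ0 j ∧ (θ.zhAt p s).quad j = (θ.zhAt p s.init).quad j) →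
        -- (V) the generation-`k` pin with the old front factor
        (∀ (V' : GaugeField (F.P p.K) (k + 1) (SU N)) (U₀ : GaugeField (F.P p.K) k (SU N)),
          (θ.zhAt p s).ζ0 k Set.univ (pairCfgAt (V := FluctV N) k V' U₀) =
            chiSeqOfRecord F N θ.ν θ.τ9.M (gOfRecord₁₃ F N θ.toStage13Params p) p.K k s.init U₀ *
              wOfRecord₉ F N θ.toStage9Params p (gOfRecord₁₃ F N θ.toStage13Params p) k s U₀ ((avOfRecord F N p.K k).avg U₀)) →
        -- `quad_k(∅) = 0` on the two-scale configurations
        (∀ (V' : GaugeField (F.P p.K) (k + 1) (SU N)) (U₀ : GaugeField (F.P p.K) k (SU N)), (θ.zhAt p s).quad k ∅ (pairCfgAt (V := FluctV N) k V' U₀) = 0) →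
        -- `k`-locality of `quad_j(Λ_{j+1})`, `j < k`
        (∀ j, j < k → ∀ ω ω' : MultiCfg (F.P p.K) (SU N) (FluctV N), (∀ i, i ≤ k → ω i = ω' i) →
          (θ.zhAt p s).quad j (s.init.Λ (j + 1)) ω = (θ.zhAt p s).quad j (s.init.Λ (j + 1)) ω') →
        -- measurability of the residual serving `s′`
        (∀ j (Y : Set (Site (F.P p.K) 0)), Measurable ((θ.zhAt p s).ζ0 j Y)) →
        (∀ j (Λ' : Set (Site (F.P p.K) 0)), Measurable ((θ.zhAt p s).quad j Λ')) →
        -- per old branch: A-fibre domination (K0b)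
        (∀ S ∈ admSOfRecord F θ.ν θ.τ9.M (gOfRecord₁₃ F N θ.toStage13Params p) p.K k s.init, ∀ j : ℕ,
          ∃ ŵ : (↥(Set.toFinite (B10Eq42TorusConstraint.bondsIn j ((s.init.Λ (j + 1))ᶜ ∩ s.init.Ω (j + 1)))).toFinset → FluctV N) → ℝ≥0∞, Measurable ŵ ∧
            (∫⁻ a, ŵ a ∂(Measure.pi fun _ : ↥(Set.toFinite (B10Eq42TorusConstraint.bondsIn j ((s.init.Λ (j + 1))ᶜ ∩ s.init.Ω (j + 1)))).toFinset => (volume : Measure (FluctV N)))) ≠ ⊤ ∧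
            ∀ ω, ENNReal.ofReal ((WtOfRecord₁₃H F N θ p s).w j (s.init.Λ (j + 1)) ((s.init.Λ (j + 1))ᶜ ∩ s.init.Ω (j + 1)) (S (j + 1)) ω) ≤
              ŵ (fun b : ↥(Set.toFinite (B10Eq42TorusConstraint.bondsIn j ((s.init.Λ (j + 1))ᶜ ∩ s.init.Ω (j + 1)))).toFinset => (ω j).2 b)) →
        (slotsTOfRecord F N θ.ν θ.τ9 (EOfRecord₁₃ F N θ.toStage13Params) (wOfRecord₉ F N θ.toStage9Params) θ.ppSel p
            (gOfRecord₁₃ F N θ.toStage13Params p) (k + 1) s = 0 ∨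
          ∀ᵐ V' ∂fieldMeasure (F.P p.K) (k + 1) (SU N),
            chiSeqOfRecord F N θ.ν θ.τ9.M (gOfRecord₁₃ F N θ.toStage13Params p) p.K (k + 1) s V' ≠ 0 →
              slotsTOfRecord F N θ.ν θ.τ9 (EOfRecord₁₃ F N θ.toStage13Params) (wOfRecord₉ F N θ.toStage9Params) θ.ppSel p
                  (gOfRecord₁₃ F N θ.toStage13Params p) (k + 1) s V' =
                sect2Slot F N (FluctV N) p.K (settingOfRecord₁₃ F N θ.toStage13Params p) (θ.rzAt p s) (WtOfRecord₁₃H F N θ p s) s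
                  (t s.init) (Ek s.init) (UbgOfRecord₁₃CoP F N θ.toStage13Params p (k + 1) s) V') := by
  -- g10's fluctuation truncation at level `k`, then the space truncation with retracted boundary terms
  have hform₁ := hasSect2FormAtZS_truncTermValues (settingOfRecord₁₃ F N θ.toStage13Params p) (Nat.le_succ k) (θ.rzAt p) (WtOfRecord₁₃H F N θ p)
    (UbgOfRecord₁₃CoP F N θ.toStage13Params p k) _ _
    (fun s₀ t' ht' => lawsRT_truncTermValues (settingOfRecord₁₃ F N θ.toStage13Params p) (θ.rzAt p s₀) s₀.Ω t' _ k k ht') hform₀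
  have hg : ∀ j, 1 ≤ j → j ≤ k → 0 ≤ (settingOfRecord₁₃ F N θ.toStage13Params p).flow.g (j - 1) ∧
      (settingOfRecord₁₃ F N θ.toStage13Params p).flow.g (j - 1) ≤ (settingOfRecord₁₃ F N θ.toStage13Params p).lf.γ :=
    fun j _ hj => ⟨(hw (j - 1) (by omega)).1.le, (hw (j - 1) (by omega)).2⟩
  have h1 : ∀ (s₀ : SeqOfRecord F θ.ν θ.τ9.M (gOfRecord₁₃ F N θ.toStage13Params p) p.K k) (j : ℕ), 1 ≤ j → j ≤ k →
      ∀ X : (Sect2.domSys (F.P p.K) θ.τ9.M j).Dom,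
      Sect2.ofBackgroundC (settingOfRecord₁₃ F N θ.toStage13Params p).ι (1 : GaugeField (F.P p.K) 0 (SU N)) ∈
        Sect2.spaceI (settingOfRecord₁₃ F N θ.toStage13Params p) (θ.rzAt p s₀) θ.τ9.M j (Sect2.domSites (F.P p.K) θ.τ9.M j X)
          ((settingOfRecord₁₃ F N θ.toStage13Params p).lf.alpha0 ((settingOfRecord₁₃ F N θ.toStage13Params p).flow.g j))
          ((settingOfRecord₁₃ F N θ.toStage13Params p).lf.alpha1 ((settingOfRecord₁₃ F N θ.toStage13Params p).flow.g j)) :=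
    fun s₀ j _ hj X => Sect2.one_mem_spaceI _ (settingOfRecord₁₃_pos F N θ.toStage13Params hpos p).cB_pos (h.rzAtLaws p s₀) θ.τ9.M j _
      (alphaPos₁₃_of_inInterval hθ hw hj).1 (alphaPos₁₃_of_inInterval hθ hw hj).2
  have hformT := hasSect2FormAtZS_spaceTruncR (settingOfRecord₁₃ F N θ.toStage13Params p) (le_refl k) (θ.rzAt p) (WtOfRecord₁₃H F N θ p)
    (UbgOfRecord₁₃CoP F N θ.toStage13Params p k) _
    (fun s₀ j U₀ => PlaqSmallOn (plaqsOf (pts j (Γr s₀ j (s₀.Ω (j + 1))ᶜ))) (cR * epsOfRecord θ.ν (gOfRecord₁₃ F N θ.toStage13Params p) j) U₀)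
    (fun s₀ j _ ω hz => plaqSmallOn_readOn_of_zetaP_ne_zero (hreg s₀) s₀.Ω j hz) hg h1
    (fun s₀ Wc hχ hR j h1j hjk X => hbg s₀ Wc ⟨hχ, hR⟩ j h1j hjk X) hform₁
  refine ⟨fun s₀ => spaceTruncR (settingOfRecord₁₃ F N θ.toStage13Params p) k (truncTermValues k (t₀ s₀)), E₀, hformT,
    fun s₀ => isFluctLocal_spaceTruncR (isFluctLocal_truncTermValues k (t₀ s₀)) _ k, fun s hΩ hpre hZ hq hqloc hζm hqm hW => ?_⟩
  refine clause_succ_CoPH_of_Omega_empty_of_pinChi_of_oldBranch_of_clause_of_graph θ p h hk hM s hΩ hqloc hpre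
    (spaceTruncR (settingOfRecord₁₃ F N θ.toStage13Params p) k (truncTermValues k (t₀ s.init))) (E₀ s.init)
    (fun S a a' Uf ha => action23_sect2ActionDataOfRecord_congr_fluct_of_isFluctLocal p.K _ _ s.init
      (isFluctLocal_spaceTruncR (isFluctLocal_truncTermValues k (t₀ s.init)) _ k) (E₀ s.init) S a a' ha Uf)
    (hformT.2 s.init).2 hZ hq fun S hSm => ?_
  choose ŵ hŵm hŵfin hdom using hW S hSm
  haveI : BorelSpace (GaugeField (F.P p.K) 0 (SU N)) := inferInstanceAs (BorelSpace (PBond (F.P p.K) 0 → SU N))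
  have hcont : Continuous fun U : GaugeField (F.P p.K) 0 (SU N) => Sect2.ofBackgroundC (settingOfRecord₁₃ F N θ.toStage13Params p).ι U :=
    continuous_ofBackgroundC_ιSU
  have hΦm := measurable_sect2Operand_of_termRows p.K (settingOfRecord₁₃ F N θ.toStage13Params p) (θ.rzAt p s.init) s.init
    (spaceTruncR (settingOfRecord₁₃ F N θ.toStage13Params p) k (truncTermValues k (t₀ s.init))) (E₀ s.init)
    (measurable_UbgOfRecord₁₃CoP F N θ.toStage13Params p k s.init) S
    (fun j X z g' => measurable_re_spaceTrunc_E_comp _ k (truncTermValues k (t₀ s.init)) hcont j X z g')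
    (fun j X => measurable_re_spaceTrunc_R_comp _ k (truncTermValues k (t₀ s.init)) hcont j X)
    (fun j X => measurable_re_spaceTruncR_B_comp_of_borel _ k (truncTermValues k (t₀ s.init)) j X (fl := fun a : MSFluct (F.P p.K) (FluctV N) => (S, a))
      (measurable_B_truncTermValues_of_borel (t₀ s.init) k j X S (hBt s.init S j X)))
  obtain ⟨CE, hCE⟩ := exists_bound_spaceTrunc_E (settingOfRecord₁₃ F N θ.toStage13Params p) k (truncTermValues k (t₀ s.init))
  obtain ⟨CR, hCR⟩ := exists_bound_spaceTrunc_R (settingOfRecord₁₃ F N θ.toStage13Params p) k (truncTermValues k (t₀ s.init))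
  obtain ⟨CB, hCB⟩ := exists_bound_spaceTruncR_B (settingOfRecord₁₃ F N θ.toStage13Params p) k (truncTermValues k (t₀ s.init))
  obtain ⟨CΦ, hΦle⟩ := exists_bound_sect2Operand_of_termBounds p.K (settingOfRecord₁₃ F N θ.toStage13Params p) (θ.rzAt p s.init) s.init
    (spaceTruncR (settingOfRecord₁₃ F N θ.toStage13Params p) k (truncTermValues k (t₀ s.init))) (E₀ s.init) (UbgOfRecord₁₃CoP F N θ.toStage13Params p k s.init)
    ⟨CE, fun j X z g' U => hCE j X z g' _⟩ ⟨CR, fun j X U => hCR j X _⟩ ⟨CB, fun j X U a => hCB j X _ a⟩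
  exact integrable_oldBranch_of_dominated θ p h.zhLaws hU s S hζm hqm ŵ hŵm
    (fun j => (∫⁻ a, ŵ j a ∂(Measure.pi fun _ : ↥(Set.toFinite (B10Eq42TorusConstraint.bondsIn j ((s.init.Λ (j + 1))ᶜ ∩ s.init.Ω (j + 1)))).toFinset => (volume : Measure (FluctV N)))).toNNReal)
    (fun j => le_of_eq (ENNReal.coe_toNNReal (hŵfin j)).symm) hdom
    (Φ := sect2Operand F N (FluctV N) p.K (settingOfRecord₁₃ F N θ.toStage13Params p) (θ.rzAt p s.init) s.init
      (spaceTruncR (settingOfRecord₁₃ F N θ.toStage13Params p) k (truncTermValues k (t₀ s.init))) (E₀ s.init) (UbgOfRecord₁₃CoP F N θ.toStage13Params p k s.init))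
    hΦm (fun a U => (sect2Operand_pos p.K _ _ s.init _ (E₀ s.init) _ a U).le) CΦ hΦle

end Record

end Summit.QuantumFields.YangMills.Theorems.BalabanUVNodesN11SpaceTruncationBorelB

end
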